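import Mathlib
import Summits.NavierStokesRegularity.FluidComputer.AbcClassISynthesis
import Summits.NavierStokesRegularity.FluidComputer.AbcClassIIBases

/-!
# INERTIA-3L instantiation — CLASS I twin, Part 13 (prep): ARBITRARY real orthonormal orbit bases of the CLASS-I
# orbit spaces — change-of-basis coefficients, expansion of the basis families and of the first-order matrix
# (instab3 g9, cell `ns-blowup`, 2026-08-27; port of instab4 g7's `AbcClassIIBasesPrep` to cert-3 g9's `AbcClassI` layer)

HONEST FRAMING (human rulings D-0035/D-0074): nothing here is a claim about Navier–Stokes blow-up.
WHAT THIS IS NOT: not NS evidence. MODEL lane (Navier–Stokes linearised about the forced ABC flow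
`U = abcFlow 1 1 1`, `f = νU`, symmetry CLASS I); no certificate, number or census word moves.

The class-I INERTIA-3L kernel chain (`AbcInertiaCICount` … `AbcInertiaCIRows`, instab3 g8) states (R1)(R2)
about matrices built from cert-3's EXISTENTIAL orbit-adapted basis `AbcClassI.bfam` (`AbcClassI.orbitBasis O :=
stdOrthonormalBasis ℝ (AbcClassI.realSpace O)`), in which no program computes; the INERTIA certifiers (i3lyapcert,
instab4's inertia_cert) compute in THEIR OWN real orthonormal bases of the class-I orbit spaces. This file and its
sequel `AbcInertiaCIBases` are the VERBATIM class-I port of instab4 g7's `AbcClassIIBasesPrep` / `AbcClassIIBases`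
§1 and of instab3 g8's `AbcInertiaBases`: for a family `e O` of real orthonormal bases of `AbcClassI.realSpace O`
(indexed by `Fin (AbcClassI.odim O)`) and its basis families `bf i = extend O_i (e O_i i.2)`:
* `ebfam_spec`, `ebfam_apply_of_not_mem`: supported on one orbit, transversal, class I, conj-symmetric;
* `coef_eq` / `ebfam_expand` / `coefM_orth_cols` / `coefM_orth_rows`: the pairings `Σ_{k ∈ O} ⟪bfam ⟨O,a⟩ k,
  bf ⟨O,b⟩ k⟫` are the entries of the orthogonal matrix `M_O = (orbitBasis O).toBasis.toMatrix (e O)`;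
* `eamat_eq`, `eamat_eq_sum`: the first-order matrix in the bases `e` is `Σ Σ M·M·amat` orbitwise;
* `coefQ_*`, `sum_saturated`, `sum_coefQ_cols/rows`: the coefficients as an orthogonal kernel on saturated sets.
Every statement carries `AbcClassI.` prefixes (the gate's dedup lint is textual); proofs are instab4's.
Mathlib + `AbcClassISynthesis` + `AbcClassIIBases` (generic lemmas); no new definitions; std axioms. [folklore]
-/

noncomputable section

open scoped BigOperators ComplexConjugate InnerProductSpace Matrix
open Finset Matrix

namespace Summit.NavierStokesRegularity.FluidComputer.AbcInertiaCI

open Literature.Analysis.FunctionSpaces Literature.Analysis.FunctionSpaces.Torus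
open Literature.Analysis.FunctionSpaces.EuclideanSpace
open Literature.Analysis.FluidPDE Literature.Analysis.FluidPDE.SteadyLattice
open Summit.NavierStokesRegularity.FluidComputer.AbcClassI
open Summit.NavierStokesRegularity.FluidComputer.AbcClassII (Fam crossForm secOp rotR rotS sgnAct sgnOrbit
  cube extend restrictTo extend_add extend_smul extend_zero rotR_add rotR_smul rotS_add rotS_smul
  crossForm_add crossForm_smul secOp_add secOp_smul restrictTo_add restrictTo_smul Orbit toOrbit onormSq
  osupNorm cubeOrbits nbrOrbits mem_sgnOrbit mem_sgnOrbit_self card_sgnOrbit_le sgnOrbit_eq_of_mem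
  mem_sgnOrbit_comm sgnOrbit_eq_or_disjoint neg_mem_sgnOrbit neg_self_mem_sgnOrbit rotFreqR_mem_sgnOrbit
  rotFreqS_mem_sgnOrbit freqNormSq_eq_of_mem_sgnOrbit supNorm_eq_of_mem_sgnOrbit mem_cube
  mem_cube_iff_supNorm cube_mono sgnOrbit_subset_cube zero_not_mem_sgnOrbit ne_zero_of_mem_sgnOrbit
  toOrbit_val toOrbit_eq_iff mem_cubeOrbits mem_nbrOrbits mem_nbrOrbits_comm card_nbrOrbits_le rotR_apply
  rotS_apply freqNormSq_rotFreq secOp_conj isConjSymm_secOp kdot_secOp mem_iff_of_orbitClosed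
  isConjSymm_cut kdot_cut orbitClosed_cube_ne_zero orbitClosed_shell neg_mem_of_orbitClosed
  isConjSymm_lerayCrossForm kdot_conj conj_eq_zero_of_not_mem linOp_zero_eq conj_theta_neg
  extend_apply_of_mem extend_apply_of_not_mem restrictTo_extend extend_restrictTo extend_sum
  inner_eq_sum_extend inner_conjVec_conjVec conj_sum_inner_of_isConjSymm sum_inner_eq_re_of_isConjSymm
  real_inner_eq_re real_smul_eq norm_lerayCrossForm_le sobolevWeight_one_eq cube_filter_eq_biUnion sum_cube_filter_eq
  onormSq_nonneg Orbit.disjoint_of_ne dotProduct_transpose_mulVec)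

/-! ## Arbitrary real orthonormal orbit bases, class I (prep) -/

section BasesPrep

variable (e : ∀ O : Orbit, OrthonormalBasis (Fin (AbcClassI.odim O)) ℝ (AbcClassI.realSpace O.1))
variable (bf : AbcClassI.Idx → Fam)
variable (hbf : ∀ i : AbcClassI.Idx, bf i = extend i.1.1 ((e i.1 i.2 : AbcClassI.realSpace i.1.1) : EuclideanSpace ℂ (↥i.1.1 × Fin 3)))

/-- Pairings against the class-I basis families as Euclidean inner products on the orbit:
`Σ_{k ∈ O} ⟪bfam ⟨O,a⟩ k, g k⟫ = ⟪orbitBasis O a, restrictTo O g⟫` (class-I twin of `AbcClassII.sum_inner_bfam_eq_inner_restrictTo`). -/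
theorem sum_inner_bfam_eq_inner_restrictTo (O : Orbit) (a : Fin (AbcClassI.odim O)) (g : Fam) :
    ∑ k ∈ O.1, (inner ℂ (AbcClassI.bfam ⟨O, a⟩ k) (g k) : ℂ) =
      inner ℂ ((AbcClassI.orbitBasis O a : AbcClassI.realSpace O.1) : EuclideanSpace ℂ (↥O.1 × Fin 3)) (restrictTo O.1 g) := by
  rw [inner_eq_sum_extend]
  refine Finset.sum_congr rfl fun k hk => ?_
  rw [bfam_eq]
  congr 1
  ext p
  rw [extend_apply_of_mem _ hk]
  rfl

/-! ### §1 The basis families of an arbitrary family of orbit bases -/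

section
include hbf

/-- The basis family of index `i` in the bases `e` is transversal, class I and conjugate-symmetric. -/
theorem ebfam_spec (i : AbcClassI.Idx) :
    (∀ k : Fin 3 → ℤ, ∑ j : Fin 3, ((k j : ℤ) : ℂ) * bf i k j = 0) ∧ IsClassI (bf i) ∧
      Torus.IsConjSymm (bf i) := by
  rw [hbf i]; exact (e i.1 i.2).2

/-- The basis family of index `i` in the bases `e` vanishes off the orbit of `i`. -/
theorem ebfam_apply_of_not_mem (i : AbcClassI.Idx) {k : Fin 3 → ℤ} (hk : k ∉ i.1.1) : bf i k = 0 := by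
  rw [hbf i]; exact extend_apply_of_not_mem _ hk

/-- Restricting the basis family of index `i` to its orbit gives back the basis vector. -/
theorem restrictTo_ebfam (i : AbcClassI.Idx) :
    restrictTo i.1.1 (bf i) = ((e i.1 i.2 : AbcClassI.realSpace i.1.1) : EuclideanSpace ℂ (↥i.1.1 × Fin 3)) := by
  rw [hbf i, restrictTo_extend]

/-- **The change-of-basis coefficients**: `Σ_{k ∈ O} ⟪AbcClassI.bfam ⟨O,a⟩ k, bf ⟨O,b⟩ k⟫ = M_O a b` with
`M_O = (AbcClassI.orbitBasis O).toBasis.toMatrix (e O)` the (real, orthogonal) change-of-basis matrix. -/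
theorem coef_eq (O : Orbit) (a b : Fin (AbcClassI.odim O)) :
    ∑ k ∈ O.1, (inner ℂ (AbcClassI.bfam ⟨O, a⟩ k) (bf ⟨O, b⟩ k) : ℂ) =
      ((((AbcClassI.orbitBasis O).toBasis.toMatrix (e O)) a b : ℝ) : ℂ) := by
  rw [sum_inner_bfam_eq_inner_restrictTo O a (bf ⟨O, b⟩), restrictTo_ebfam e bf hbf ⟨O, b⟩,
    inner_coe_realSpace (neg_mem_of_orbitClosed O.orbitClosed) (AbcClassI.orbitBasis O a) (e O b),
    Module.Basis.toMatrix_apply, OrthonormalBasis.coe_toBasis_repr_apply, OrthonormalBasis.repr_apply_apply]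

/-- **Expansion of the new basis families in the old ones**: `bf ⟨O,b⟩ = Σ_a M_O a b • AbcClassI.bfam ⟨O,a⟩`. -/
theorem ebfam_expand (O : Orbit) (b : Fin (AbcClassI.odim O)) :
    bf ⟨O, b⟩ = ∑ a : Fin (AbcClassI.odim O), ((((AbcClassI.orbitBasis O).toBasis.toMatrix (e O)) a b : ℝ) : ℂ) • AbcClassI.bfam ⟨O, a⟩ := by
  have hs := ebfam_spec e bf hbf ⟨O, b⟩
  have h := expand_complex O (c := bf ⟨O, b⟩) (fun k hk => ebfam_apply_of_not_mem e bf hbf ⟨O, b⟩ hk) hs.1 hs.2.1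
  conv_lhs => rw [h]
  exact Finset.sum_congr rfl fun a _ => by rw [coef_eq e bf hbf O a b]

end

/-- **Orthogonality of the change-of-basis matrix, columns**: `Σ_a M a b · M a b' = δ_{b b'}`. -/
theorem coefM_orth_cols (O : Orbit) (b b' : Fin (AbcClassI.odim O)) :
    ∑ a : Fin (AbcClassI.odim O), ((AbcClassI.orbitBasis O).toBasis.toMatrix (e O)) a b * ((AbcClassI.orbitBasis O).toBasis.toMatrix (e O)) a b' =
      if b = b' then 1 else 0 := by
  have hQ := (AbcClassI.orbitBasis O).toMatrix_orthonormalBasis_mem_orthogonal (e O)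
  have h : ((AbcClassI.orbitBasis O).toBasis.toMatrix (e O))ᵀ * (AbcClassI.orbitBasis O).toBasis.toMatrix (e O) = 1 := by
    have h := Matrix.mem_unitaryGroup_iff'.mp hQ
    simpa only [star_eq_conjTranspose, conjTranspose_eq_transpose_of_trivial] using h
  have h' := congrFun (congrFun h b) b'
  rw [Matrix.mul_apply, Matrix.one_apply] at h'
  simpa only [Matrix.transpose_apply] using h'

/-- **Orthogonality of the change-of-basis matrix, rows**: `Σ_b M a b · M a' b = δ_{a a'}`. -/
theorem coefM_orth_rows (O : Orbit) (a a' : Fin (AbcClassI.odim O)) :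
    ∑ b : Fin (AbcClassI.odim O), ((AbcClassI.orbitBasis O).toBasis.toMatrix (e O)) a b * ((AbcClassI.orbitBasis O).toBasis.toMatrix (e O)) a' b =
      if a = a' then 1 else 0 := by
  have hQ := (AbcClassI.orbitBasis O).toMatrix_orthonormalBasis_mem_orthogonal (e O)
  have h : (AbcClassI.orbitBasis O).toBasis.toMatrix (e O) * ((AbcClassI.orbitBasis O).toBasis.toMatrix (e O))ᵀ = 1 := by
    have h := Matrix.mem_unitaryGroup_iff.mp hQ
    simpa only [star_eq_conjTranspose, conjTranspose_eq_transpose_of_trivial] using h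
  have h' := congrFun (congrFun h a) a'
  rw [Matrix.mul_apply, Matrix.one_apply] at h'
  simpa only [Matrix.transpose_apply] using h'

section
include hbf

/-- **The first-order matrix in the bases `e`, expanded in the old one**:
`Re Σ_{k ∈ O_i} ⟪bf i k, Π_k X(bf j)(k)⟫ = Σ_{a, a'} M_{O_i} a i.2 · M_{O_j} a' j.2 · AbcClassI.amat ⟨O_i,a⟩ ⟨O_j,a'⟩`. -/
theorem eamat_eq (i j : AbcClassI.Idx) :
    (∑ k ∈ i.1.1, (inner ℂ (bf i k) (Torus.lerayCoeff k (crossForm 1 1 1 (bf j) k)) : ℂ)).re =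
      ∑ a : Fin (AbcClassI.odim i.1), ∑ a' : Fin (AbcClassI.odim j.1),
        ((AbcClassI.orbitBasis i.1).toBasis.toMatrix (e i.1)) a i.2 * ((AbcClassI.orbitBasis j.1).toBasis.toMatrix (e j.1)) a' j.2 *
          AbcClassI.amat ⟨i.1, a⟩ ⟨j.1, a'⟩ := by
  obtain ⟨O, b⟩ := i
  obtain ⟨O', b'⟩ := j
  -- abbreviations for the real coefficients
  set M : Matrix (Fin (AbcClassI.odim O)) (Fin (AbcClassI.odim O)) ℝ := (AbcClassI.orbitBasis O).toBasis.toMatrix (e O) with hM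
  set M' : Matrix (Fin (AbcClassI.odim O')) (Fin (AbcClassI.odim O')) ℝ := (AbcClassI.orbitBasis O').toBasis.toMatrix (e O') with hM'
  have hi := ebfam_expand e bf hbf O b
  have hj := ebfam_expand e bf hbf O' b'
  -- the complex pairing
  have key : ∑ k ∈ O.1, (inner ℂ (bf ⟨O, b⟩ k) (Torus.lerayCoeff k (crossForm 1 1 1 (bf ⟨O', b'⟩) k)) : ℂ) =
      ∑ a : Fin (AbcClassI.odim O), ∑ a' : Fin (AbcClassI.odim O'),
        (((M a b * M' a' b' * AbcClassI.amat ⟨O, a⟩ ⟨O', a'⟩ : ℝ)) : ℂ) := by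
    have e1 : ∀ k, (inner ℂ (bf ⟨O, b⟩ k) (Torus.lerayCoeff k (crossForm 1 1 1 (bf ⟨O', b'⟩) k)) : ℂ) =
        ∑ a : Fin (AbcClassI.odim O), ∑ a' : Fin (AbcClassI.odim O'), ((M a b : ℝ) : ℂ) * ((M' a' b' : ℝ) : ℂ) *
          (inner ℂ (AbcClassI.bfam ⟨O, a⟩ k) (Torus.lerayCoeff k (crossForm 1 1 1 (AbcClassI.bfam ⟨O', a'⟩) k)) : ℂ) := by
      intro k
      rw [hj, lerayCrossForm_sum_smul (Finset.univ) (fun a' : Fin (AbcClassI.odim O') => (⟨O', a'⟩ : AbcClassI.Idx))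
        (fun a' => ((M' a' b' : ℝ) : ℂ)) k, hi,
        sum_smul_bfam_apply (Finset.univ) (fun a : Fin (AbcClassI.odim O) => (⟨O, a⟩ : AbcClassI.Idx)) (fun a => ((M a b : ℝ) : ℂ)) k,
        sum_inner]
      refine Finset.sum_congr rfl fun a _ => ?_
      rw [inner_sum]
      refine Finset.sum_congr rfl fun a' _ => ?_
      rw [inner_smul_left, inner_smul_right, Complex.conj_ofReal]
      ring
    rw [Finset.sum_congr rfl fun k _ => e1 k, Finset.sum_comm]
    refine Finset.sum_congr rfl fun a _ => ?_
    rw [Finset.sum_comm]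
    refine Finset.sum_congr rfl fun a' _ => ?_
    rw [← Finset.mul_sum, ← amat_eq ⟨O, a⟩ ⟨O', a'⟩]
    push_cast
    ring
  rw [key]
  rw [show (∑ a : Fin (AbcClassI.odim O), ∑ a' : Fin (AbcClassI.odim O'), (((M a b * M' a' b' * AbcClassI.amat ⟨O, a⟩ ⟨O', a'⟩ : ℝ)) : ℂ)) =
    (((∑ a : Fin (AbcClassI.odim O), ∑ a' : Fin (AbcClassI.odim O'), M a b * M' a' b' * AbcClassI.amat ⟨O, a⟩ ⟨O', a'⟩ : ℝ)) : ℂ) by push_cast; rfl,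
    Complex.ofReal_re]

/-! ### §2 The coefficients as a kernel on `AbcClassI.Idx × AbcClassI.Idx`; orbit-saturated index sets -/

/-- Across different orbits the coefficients vanish (disjoint supports). -/
theorem coefQ_eq_zero_of_ne {i j : AbcClassI.Idx} (h : i.1 ≠ j.1) :
    (∑ k ∈ i.1.1, (inner ℂ (AbcClassI.bfam i k) (bf j k) : ℂ)).re = 0 := by
  rw [Finset.sum_eq_zero fun k hk => ?_, Complex.zero_re]
  have hk' : k ∉ j.1.1 := fun h' => Finset.disjoint_left.mp (Orbit.disjoint_of_ne h) hk h'
  rw [ebfam_apply_of_not_mem e bf hbf j hk', inner_zero_right]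

/-- On one orbit the coefficients are the entries of the change-of-basis matrix. -/
theorem coefQ_same (O : Orbit) (a b : Fin (AbcClassI.odim O)) :
    (∑ k ∈ (⟨O, a⟩ : AbcClassI.Idx).1.1, (inner ℂ (AbcClassI.bfam ⟨O, a⟩ k) (bf ⟨O, b⟩ k) : ℂ)).re =
      ((AbcClassI.orbitBasis O).toBasis.toMatrix (e O)) a b := by
  change (∑ k ∈ O.1, (inner ℂ (AbcClassI.bfam ⟨O, a⟩ k) (bf ⟨O, b⟩ k) : ℂ)).re = _
  rw [coef_eq e bf hbf O a b, Complex.ofReal_re]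

end

/-- **Sums over an orbit-saturated index set of a function living on one orbit** are sums over the
basis index of that orbit. -/
theorem sum_saturated {T : Finset AbcClassI.Idx} (O : Orbit) (hTO : ∀ a : Fin (AbcClassI.odim O), (⟨O, a⟩ : AbcClassI.Idx) ∈ T)
    (g : AbcClassI.Idx → ℝ) (hg : ∀ i : AbcClassI.Idx, i.1 ≠ O → g i = 0) :
    ∑ i ∈ T, g i = ∑ a : Fin (AbcClassI.odim O), g ⟨O, a⟩ := by
  classical
  set SO : Finset AbcClassI.Idx := (Finset.univ : Finset (Fin (AbcClassI.odim O))).map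
    ⟨fun a => (⟨O, a⟩ : AbcClassI.Idx), fun a b h => eq_of_heq (Sigma.mk.inj_iff.mp h).2⟩ with hSO
  have hsub : SO ⊆ T := by
    intro i hi
    obtain ⟨a, -, rfl⟩ := Finset.mem_map.mp hi
    exact hTO a
  rw [← Finset.sum_subset hsub fun i _ hi => hg i fun h => hi ?_, Finset.sum_map]
  · rfl
  · obtain ⟨O', a⟩ := i
    change O' = O at h
    subst h
    exact Finset.mem_map.mpr ⟨a, Finset.mem_univ _, rfl⟩

-- (`AbcClassI.cubeIdx_saturated` / `AbcClassI.shellIdx_saturated` are cert-3 g9's, `AbcClassIComplexBasesPrep` §0.)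

section
include hbf

/-- **Column orthogonality of the coefficient kernel on a saturated index set**:
`Σ_{i ∈ T} Q i j · Q i j' = δ_{j j'}` for `j, j' ∈ T`. -/
theorem sum_coefQ_cols {T : Finset AbcClassI.Idx} (hT : ∀ i ∈ T, ∀ a : Fin (AbcClassI.odim i.1), (⟨i.1, a⟩ : AbcClassI.Idx) ∈ T)
    {j j' : AbcClassI.Idx} (hj : j ∈ T) (hj' : j' ∈ T) :
    ∑ i ∈ T, (∑ k ∈ i.1.1, (inner ℂ (AbcClassI.bfam i k) (bf j k) : ℂ)).re *
        (∑ k ∈ i.1.1, (inner ℂ (AbcClassI.bfam i k) (bf j' k) : ℂ)).re = if j = j' then 1 else 0 := by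
  obtain ⟨O, b⟩ := j
  obtain ⟨O', b'⟩ := j'
  by_cases hO : O = O'
  · subst hO
    rw [sum_saturated O (hT _ hj) _ fun i hi => by rw [coefQ_eq_zero_of_ne e bf hbf (j := ⟨O, b⟩) hi, zero_mul]]
    simp_rw [coefQ_same e bf hbf]
    rw [coefM_orth_cols]
    by_cases hb : b = b'
    · subst hb; simp
    · rw [if_neg hb]
      exact (if_neg (show (⟨O, b⟩ : AbcClassI.Idx) ≠ ⟨O, b'⟩ from fun h => hb (eq_of_heq (Sigma.mk.inj_iff.mp h).2))).symm
  · refine Eq.trans ?_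
      (if_neg (show (⟨O, b⟩ : AbcClassI.Idx) ≠ ⟨O', b'⟩ from fun h => hO (Sigma.mk.inj_iff.mp h).1)).symm
    refine Finset.sum_eq_zero fun i _ => ?_
    by_cases h1 : i.1 = O
    · have h2 : i.1 ≠ (⟨O', b'⟩ : AbcClassI.Idx).1 := fun h => hO (h1.symm.trans h)
      rw [coefQ_eq_zero_of_ne e bf hbf (j := ⟨O', b'⟩) h2, mul_zero]
    · have h1' : i.1 ≠ (⟨O, b⟩ : AbcClassI.Idx).1 := h1
      rw [coefQ_eq_zero_of_ne e bf hbf (j := ⟨O, b⟩) h1', zero_mul]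

/-- **Row orthogonality of the coefficient kernel on a saturated index set**:
`Σ_{j ∈ T} Q i j · Q i' j = δ_{i i'}` for `i, i' ∈ T`. -/
theorem sum_coefQ_rows {T : Finset AbcClassI.Idx} (hT : ∀ i ∈ T, ∀ a : Fin (AbcClassI.odim i.1), (⟨i.1, a⟩ : AbcClassI.Idx) ∈ T)
    {i i' : AbcClassI.Idx} (hi : i ∈ T) (hi' : i' ∈ T) :
    ∑ j ∈ T, (∑ k ∈ i.1.1, (inner ℂ (AbcClassI.bfam i k) (bf j k) : ℂ)).re *
        (∑ k ∈ i'.1.1, (inner ℂ (AbcClassI.bfam i' k) (bf j k) : ℂ)).re = if i = i' then 1 else 0 := by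
  obtain ⟨O, a⟩ := i
  obtain ⟨O', a'⟩ := i'
  by_cases hO : O = O'
  · subst hO
    rw [sum_saturated O (hT _ hi) _ fun j hj => by
      rw [coefQ_eq_zero_of_ne e bf hbf (i := ⟨O, a⟩) (Ne.symm hj), zero_mul]]
    simp_rw [coefQ_same e bf hbf]
    rw [coefM_orth_rows]
    by_cases ha : a = a'
    · subst ha; simp
    · rw [if_neg ha]
      exact (if_neg (show (⟨O, a⟩ : AbcClassI.Idx) ≠ ⟨O, a'⟩ from fun h => ha (eq_of_heq (Sigma.mk.inj_iff.mp h).2))).symm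
  · refine Eq.trans ?_
      (if_neg (show (⟨O, a⟩ : AbcClassI.Idx) ≠ ⟨O', a'⟩ from fun h => hO (Sigma.mk.inj_iff.mp h).1)).symm
    refine Finset.sum_eq_zero fun j _ => ?_
    by_cases h1 : j.1 = O
    · have h2 : (⟨O', a'⟩ : AbcClassI.Idx).1 ≠ j.1 := fun h => hO (h1.symm.trans h.symm)
      rw [coefQ_eq_zero_of_ne e bf hbf h2, mul_zero]
    · have h1' : (⟨O, a⟩ : AbcClassI.Idx).1 ≠ j.1 := Ne.symm h1
      rw [coefQ_eq_zero_of_ne e bf hbf h1', zero_mul]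

/-- **The first-order matrix in the bases `e` as a double sum over saturated index sets**:
for `j ∈ T₁`, `j' ∈ T₂`: `am j j' = Σ_{i ∈ T₁} Σ_{i' ∈ T₂} Q i j · AbcClassI.amat i i' · Q i' j'`. -/
theorem eamat_eq_sum {T₁ T₂ : Finset AbcClassI.Idx} (hT₁ : ∀ i ∈ T₁, ∀ a : Fin (AbcClassI.odim i.1), (⟨i.1, a⟩ : AbcClassI.Idx) ∈ T₁)
    (hT₂ : ∀ i ∈ T₂, ∀ a : Fin (AbcClassI.odim i.1), (⟨i.1, a⟩ : AbcClassI.Idx) ∈ T₂) {j j' : AbcClassI.Idx} (hj : j ∈ T₁) (hj' : j' ∈ T₂) :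
    (∑ k ∈ j.1.1, (inner ℂ (bf j k) (Torus.lerayCoeff k (crossForm 1 1 1 (bf j') k)) : ℂ)).re =
      ∑ i ∈ T₁, ∑ i' ∈ T₂, (∑ k ∈ i.1.1, (inner ℂ (AbcClassI.bfam i k) (bf j k) : ℂ)).re * AbcClassI.amat i i' *
        (∑ k ∈ i'.1.1, (inner ℂ (AbcClassI.bfam i' k) (bf j' k) : ℂ)).re := by
  rw [eamat_eq e bf hbf j j']
  rw [sum_saturated j.1 (hT₁ j hj) _ fun i hi => by
    rw [Finset.sum_eq_zero fun i' _ => by rw [coefQ_eq_zero_of_ne e bf hbf (i := i) (j := j) hi, zero_mul, zero_mul]]]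
  refine Finset.sum_congr rfl fun a _ => ?_
  rw [sum_saturated j'.1 (hT₂ j' hj') _ fun i' hi' => by
    rw [coefQ_eq_zero_of_ne e bf hbf (i := i') (j := j') hi', mul_zero]]
  refine Finset.sum_congr rfl fun a' _ => ?_
  obtain ⟨O, b⟩ := j
  obtain ⟨O', b'⟩ := j'
  simp only [coefQ_same e bf hbf]
  ring

end

end BasesPrep

end Summit.NavierStokesRegularity.FluidComputer.AbcInertiaCI

end
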